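import Literature.Barriers.CriticalPhenomena.RandomClusterFirstOrderEdgeDensity
import Literature.Barriers.CriticalPhenomena.RandomClusterFirstOrderNarrowProofs
import Literature.Probability.LatticeModels.RandomClusterFreePercolationProbability
import HarnessLib

/-!
# `RandomClusterFirstOrderEdgeDensity` (Grimmett 2006, Thm. (7.33)(a)) is a theorem

Companion ("Proofs") file of `Literature.Barriers.CriticalPhenomena.RandomClusterFirstOrderEdgeDensity`
(the edge densities `h⁰(·,q)`, `h¹(·,q)` of the random-cluster model on `ℤ^d`, `d ≥ 2`, are discontinuous
at `p_c(q)` for `q > Q(d)`; Laanait–Messager–Miracle-Solé–Ruiz–Shlosman 1991). Theorems only; no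
definitions, no named facts, no sorries; standard axioms. It discharges the named fact as the sorry-free
theorem `RandomClusterFirstOrderEdgeDensity_holds`, from tree theorems only:

* the PROVED companion barrier `RandomClusterFirstOrderNarrow_holds` (Thm. (7.33)(b), both halves:
  `θ⁰(p_c(q),q) = 0 < θ¹(p_c(q),q)` for `q > Q(d)`; `RandomClusterFirstOrderNarrowProofs.lean`, via the
  tree's Pirogov–Sinai analysis `RandomClusterFirstOrderPS.lean`);
* Grimmett's Thm. (5.16)(c) in the tree's finite-volume form `thetaFree_eq_thetaWired_of_edgeDensity_eq`
  (`h⁰ = h¹ ⇒ θ⁰ = θ¹`) and the edge-independence of the densities ((4.61),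
  `free/wiredEdgeDensity_eq_of_mem_edgeSet`), whence **`h⁰(p_c(q),q) < h¹(p_c(q),q)`**
  (`exists_forall_freeEdgeDensity_rcCriticalProb_lt` — the two phases have different edge densities AT
  the critical point, eqs. (7.78)–(7.83));
* the elementary half (b) ⇒ (c) of Thm. (4.63): at any `p ∈ (0,1)` with `h⁰(p) < h¹(p)` neither density
  is continuous at `p`, because `h¹(p) ≤ h⁰(p')` whenever `p < p'`
  (`wiredEdgeDensity_le_freeEdgeDensity_of_lt`, proof of Thm. (4.63), (4.73)–(4.76)) —
  `not_continuousAt_freeEdgeDensity_of_lt`, `not_continuousAt_wiredEdgeDensity_of_lt`;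
* `0 < p_c(q) < 1` for `q > Q(d)` ((5.9); here read off the Pirogov–Sinai window of
  `RandomClusterFirstOrderPS`: the free phase is stable at its bottom `p_bot > 0` and the wired phase at
  its top `p_top < 1`, so `p_bot ≤ p_c(q) ≤ p_top` by (7.83)/(7.80)) — `rcCriticalProb_mem_Ioo_of_Qof_lt`.

## References

* G. Grimmett, *The Random-Cluster Model*, Springer 2006: Thm. (4.63) and its proof (4.73)–(4.77),
  (4.61), Thm. (5.16)(c), (5.9), §7.5 Thm. (7.33)(a),(b) and proof (7.78)–(7.83), Thm. (7.42). [Grimmett2006]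
* L. Laanait, A. Messager, S. Miracle-Solé, J. Ruiz, S. Shlosman, Comm. Math. Phys. 140 (1991) 81–91.
  [LaanaitMessagerMiracleSoleRuizShlosman1991]
-/

noncomputable section

open Filter Set
open scoped Topology

namespace Literature.Barriers.CriticalPhenomena

open Literature.Probability.Percolation Literature.Probability.LatticeModels

variable {d : ℕ}

/-! ### Thm. (4.63), (b) ⇒ (c): a jump `h⁰(p) < h¹(p)` makes both densities discontinuous at `p` -/

/-- If `h⁰(p,q)(e) < h¹(p,q)(e)` at some `p ∈ (0,1)` (`q ≥ 1`, `e` an edge of `ℤ^d`), then the FREE edge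
density `x ↦ h⁰(x,q)(e)` is not continuous at `p`: for `p < p' < 1`, `h¹(p) ≤ h⁰(p')` (proof of
Thm. (4.63)), so continuity from the right would force `h¹(p) ≤ h⁰(p)`.
[cite: Grimmett2006, Thm. (4.63) ((b) ⇔ (c)) and its proof, (4.73)–(4.77)] -/
theorem not_continuousAt_freeEdgeDensity_of_lt {p q : ℝ} (hp : p ∈ Set.Ioo (0 : ℝ) 1) (hq : 1 ≤ q)
    {e : Sym2 (Site d)} (he : e ∈ (zdGraph d).edgeSet)
    (hlt : freeEdgeDensity d p q e < wiredEdgeDensity d p q e) :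
    ¬ ContinuousAt (fun x : ℝ => freeEdgeDensity d x q e) p := by
  obtain ⟨i, -, -⟩ := exists_eq_map_add_of_mem_edgeSet he
  have hd : 0 < d := i.pos
  intro hcont
  -- along `p' ↓ p` inside `(p, 1)`: `h¹(p) ≤ h⁰(p')`, and `h⁰(p') → h⁰(p)`
  have hlim : Tendsto (fun x : ℝ => freeEdgeDensity d x q e) (𝓝[Set.Ioo p 1] p)
      (𝓝 (freeEdgeDensity d p q e)) := hcont.tendsto.mono_left nhdsWithin_le_nhds
  have hev : ∀ᶠ x in 𝓝[Set.Ioo p 1] p, wiredEdgeDensity d p q e ≤ freeEdgeDensity d x q e :=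
    eventually_nhdsWithin_of_forall fun x hx =>
      wiredEdgeDensity_le_freeEdgeDensity_of_lt hd hp.1 hx.1 hx.2 hq he
  haveI : (𝓝[Set.Ioo p 1] p).NeBot := by
    rw [← mem_closure_iff_nhdsWithin_neBot, closure_Ioo hp.2.ne]
    exact ⟨le_rfl, hp.2.le⟩
  exact absurd (ge_of_tendsto hlim hev) (not_le.2 hlt)

/-- If `h⁰(p,q)(e) < h¹(p,q)(e)` at some `p ∈ (0,1)` (`q ≥ 1`, `e` an edge of `ℤ^d`), then the WIRED edge
density `x ↦ h¹(x,q)(e)` is not continuous at `p`: for `0 < p'' < p`, `h¹(p'') ≤ h⁰(p)`, so continuity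
from the left would force `h¹(p) ≤ h⁰(p)`.
[cite: Grimmett2006, Thm. (4.63) ((b) ⇔ (c)) and its proof, (4.73)–(4.77)] -/
theorem not_continuousAt_wiredEdgeDensity_of_lt {p q : ℝ} (hp : p ∈ Set.Ioo (0 : ℝ) 1) (hq : 1 ≤ q)
    {e : Sym2 (Site d)} (he : e ∈ (zdGraph d).edgeSet)
    (hlt : freeEdgeDensity d p q e < wiredEdgeDensity d p q e) :
    ¬ ContinuousAt (fun x : ℝ => wiredEdgeDensity d x q e) p := by
  obtain ⟨i, -, -⟩ := exists_eq_map_add_of_mem_edgeSet he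
  have hd : 0 < d := i.pos
  intro hcont
  have hlim : Tendsto (fun x : ℝ => wiredEdgeDensity d x q e) (𝓝[Set.Ioo 0 p] p)
      (𝓝 (wiredEdgeDensity d p q e)) := hcont.tendsto.mono_left nhdsWithin_le_nhds
  have hev : ∀ᶠ x in 𝓝[Set.Ioo 0 p] p, wiredEdgeDensity d x q e ≤ freeEdgeDensity d p q e :=
    eventually_nhdsWithin_of_forall fun x hx =>
      wiredEdgeDensity_le_freeEdgeDensity_of_lt hd hx.1 hx.2 hp.2 hq he
  haveI : (𝓝[Set.Ioo 0 p] p).NeBot := by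
    rw [← mem_closure_iff_nhdsWithin_neBot, closure_Ioo hp.1.ne]
    exact ⟨hp.1.le, le_rfl⟩
  exact absurd (le_of_tendsto hlim hev) (not_le.2 hlt)

/-! ### `0 < p_c(q) < 1` for `q` beyond the Pirogov–Sinai threshold -/

open Literature.Probability.LatticeModels.RCC RandomClusterFirstOrderPS in
/-- **`0 < p_c(q) < 1` for `q > Q(d)`, `q ≥ 1`, `d ≥ 2`** (`Q(d) = RandomClusterFirstOrderPS.Qof d`, the
threshold of the tree's Pirogov–Sinai analysis): at the bottom `p_bot = p(t_bot) > 0` of the window the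
disordered phase is stable, so the free box measures decay there and `p_bot ≤ p_c(q)` ((7.82)–(7.83));
at the top `p_top = p(t_top) < 1` the ordered phase is stable, so `θ¹(p_top,q) ≥ 1/2 > 0` and
`p_c(q) ≤ p_top` ((7.79)–(7.80)). [cite: Grimmett2006, (5.9) and proof of Thm. (7.33), eqs. (7.79)–(7.83), with Thm. (7.42)] -/
theorem rcCriticalProb_mem_Ioo_of_Qof_lt (hd : 2 ≤ d) {q : ℝ} (hq : 1 ≤ q)
    (hQ : RandomClusterFirstOrderPS.Qof d < q) : rcCriticalProb d q ∈ Set.Ioo (0 : ℝ) 1 := by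
  have hd1 : 1 ≤ d := by omega
  have hd0 : 0 < d := by omega
  obtain ⟨hreg, hB⟩ := conditions_of_gt hd1 hq hQ
  have htb : 0 < tBot d q := Real.exp_pos _
  have htt : 0 < tTop d q := Real.exp_pos _
  have hsb : |2 * d * Real.log (tBot d q) - Real.log q| ≤ 1 := by
    rw [log_tBot hd1 q]; norm_num
  have hst : |2 * d * Real.log (tTop d q) - Real.log q| ≤ 1 := by
    rw [log_tTop hd1 q]; norm_num
  constructor
  · -- `0 < p_bot ≤ p_c(q)`
    have hfd : pOf (tBot d q) ∈ freeDecaySet d q :=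
      mem_freeDecaySet_of_dis hd hq htb hsb hreg (dis_stable_tBot hd hq hreg) hB
    exact (pOf_mem _ htb).1.trans_le
      (le_rcCriticalProb_of_freeDecay hd0 hq (pOf_mem _ htb).2.le hfd)
  · -- `p_c(q) ≤ p_top < 1`
    have hpt : pOf (tTop d q) ∈ Set.Icc (0 : ℝ) 1 := ⟨(pOf_mem _ htt).1.le, (pOf_mem _ htt).2.le⟩
    have hpos : 0 < thetaWired d (pOf (tTop d q)) q :=
      (by norm_num : (0 : ℝ) < 1 / 2).trans_le (le_thetaWired_of_forall fun n =>
        half_le_thetaWiredBox hd hq htt hst hreg (ord_stable_tTop hd hq hreg) hB (n + 1))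
    exact (rcCriticalProb_le_of_thetaWired_pos hq hpt hpos).trans_lt (pOf_mem _ htt).2

/-! ### Thm. (7.33)(a): the two phases have different edge densities at `p_c(q)` -/

/-- **Grimmett 2006, Thm. (7.33)(a), sharp form: for `d ≥ 2` there is `Q = Q(d)` such that for all
`q > Q`, `q ≥ 1`, `h⁰(p_c(q),q)(e) < h¹(p_c(q),q)(e)` at every edge `e` of `ℤ^d`.** From the proved
barrier `RandomClusterFirstOrderNarrow_holds` (`θ⁰(p_c(q),q) = 0 < θ¹(p_c(q),q)`): equal densities at
`p_c(q)` would give `θ⁰ = θ¹` there (Thm. (5.16)(c)); the densities do not depend on the edge ((4.61)),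
and `h⁰ ≤ h¹` always. [cite: Grimmett2006, Thm. (7.33)(a) and proof (7.78)–(7.83), with Thm. (5.16)(c) and (4.61)] -/
theorem exists_forall_freeEdgeDensity_rcCriticalProb_lt (hd : 2 ≤ d) :
    ∃ Q : ℝ, ∀ q : ℝ, Q < q → 1 ≤ q → ∀ e ∈ (zdGraph d).edgeSet,
      freeEdgeDensity d (rcCriticalProb d q) q e < wiredEdgeDensity d (rcCriticalProb d q) q e := by
  obtain ⟨Q, hQ⟩ := RandomClusterFirstOrderNarrow_holds d hd
  refine ⟨Q, fun q hQq hq e he => ?_⟩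
  have hd0 : 0 < d := by omega
  have hq0 : 0 < q := one_pos.trans_le hq
  obtain ⟨hfree, hwired⟩ := hQ q hQq hq
  have hpc : rcCriticalProb d q ∈ Set.Icc (0 : ℝ) 1 := rcCriticalProb_mem_Icc d q
  have hθ0 : thetaFree d (rcCriticalProb d q) q = 0 :=
    (thetaFree_eq_zero_iff_mem_freeDecaySet hpc hq0).2 hfree
  -- not all densities agree at `p_c(q)`, else `θ⁰ = θ¹` there
  have hne : ¬ ∀ e' ∈ (zdGraph d).edgeSet,
      freeEdgeDensity d (rcCriticalProb d q) q e' = wiredEdgeDensity d (rcCriticalProb d q) q e' := by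
    intro hall
    have := thetaFree_eq_thetaWired_of_edgeDensity_eq hd0 hpc hq hall
    rw [hθ0] at this
    exact hwired.ne' this.symm
  push Not at hne
  obtain ⟨e', he', hne'⟩ := hne
  refine lt_of_le_of_ne (freeEdgeDensity_le_wiredEdgeDensity hd0 hpc hq e) fun h => hne' ?_
  rw [freeEdgeDensity_eq_of_mem_edgeSet hpc hq he' he, wiredEdgeDensity_eq_of_mem_edgeSet hd0 hpc hq he' he, h]

/-- The same with `0 < p_c(q) < 1` recorded for the same `q` (the `Q` here dominates both thresholds).
[cite: Grimmett2006, Thm. (7.33)(a) and (5.9)] -/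
theorem exists_forall_rcCriticalProb_mem_Ioo_and_freeEdgeDensity_lt (hd : 2 ≤ d) :
    ∃ Q : ℝ, ∀ q : ℝ, Q < q → 1 ≤ q → rcCriticalProb d q ∈ Set.Ioo (0 : ℝ) 1 ∧
      ∀ e ∈ (zdGraph d).edgeSet,
        freeEdgeDensity d (rcCriticalProb d q) q e < wiredEdgeDensity d (rcCriticalProb d q) q e := by
  obtain ⟨Q, hQ⟩ := exists_forall_freeEdgeDensity_rcCriticalProb_lt hd
  refine ⟨max Q (RandomClusterFirstOrderPS.Qof d), fun q hq hq1 => ⟨?_, hQ q ?_ hq1⟩⟩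
  · exact rcCriticalProb_mem_Ioo_of_Qof_lt hd hq1 ((le_max_right _ _).trans_lt hq)
  · exact (le_max_left _ _).trans_lt hq

/-! ### The discharge -/

/-- **Grimmett 2006, Thm. (7.33)(a) — PROVED: for `d ≥ 2` there is `Q = Q(d)` such that for all `q > Q`,
`q ≥ 1`, and every edge `e` of `ℤ^d`, neither `p ↦ h¹(p,q)(e)` nor `p ↦ h⁰(p,q)(e)` is continuous at
`p_c(q)`.** This discharges the named fact `RandomClusterFirstOrderEdgeDensity` (Laanait–Messager–
Miracle-Solé–Ruiz–Shlosman 1991): the jump `h⁰(p_c(q)) < h¹(p_c(q))` at `0 < p_c(q) < 1` and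
Thm. (4.63) (b) ⇒ (c). [cite: Grimmett2006, Thm. (7.33)(a) and proof (7.78)–(7.83)] [cite: LaanaitMessagerMiracleSoleRuizShlosman1991, main theorem (= Grimmett2006 Thm. (7.33))] -/
theorem RandomClusterFirstOrderEdgeDensity_holds : RandomClusterFirstOrderEdgeDensity := by
  intro d hd
  obtain ⟨Q, hQ⟩ := exists_forall_rcCriticalProb_mem_Ioo_and_freeEdgeDensity_lt hd
  refine ⟨Q, fun q hQq hq e he => ?_⟩
  obtain ⟨hpc, hlt⟩ := hQ q hQq hq
  exact ⟨not_continuousAt_wiredEdgeDensity_of_lt hpc hq he (hlt e he),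
    not_continuousAt_freeEdgeDensity_of_lt hpc hq he (hlt e he)⟩

/-- Hence, unconditionally: NO `q`-uniform continuity of the wired one-edge density at criticality on
`ℤ^d`, `d ≥ 2` (the barrier's working form `RandomClusterFirstOrderEdgeDensity.not_uniform_continuousAt`).
[cite: Grimmett2006, Thm. (7.33)(a)] -/
theorem not_forall_continuousAt_wiredEdgeDensity_rcCriticalProb (hd : 2 ≤ d) :
    ¬ ∀ q : ℝ, 1 ≤ q → ∀ e ∈ (zdGraph d).edgeSet,
      ContinuousAt (fun p : ℝ => wiredEdgeDensity d p q e) (rcCriticalProb d q) :=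
  RandomClusterFirstOrderEdgeDensity_holds.not_uniform_continuousAt hd

end Literature.Barriers.CriticalPhenomena

end
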